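import Summits.BirchSwinnertonDyer.BirchSwinnertonDyer.Theses.SignedBaseChange
import Literature.NumberTheory.EllipticCurves.CastellaWan2024.GreenbergMainConjectureBDP
import Literature.NumberTheory.EllipticCurves.BertoliniLongoVenerucci2026.IndefiniteMainConjectureSupersingularBDP
import Literature.NumberTheory.EllipticCurves.YanZhu2026.GreenbergMainTheoremsAnyRoot
import Literature.NumberTheory.EllipticCurves.PAdicGrossZagierConstantTermProofs
import Literature.NumberTheory.EllipticCurves.NonEisensteinPrimeOfSurjective
import Summits.BirchSwinnertonDyer.BirchSwinnertonDyer.Theorems.SignedBaseChangeAnticyclotomicEisensteinDivisibilityFrameConcordance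
import Summits.BirchSwinnertonDyer.Rank1Residual.X11b.RouteR1IntReceptacle
import Summits.BirchSwinnertonDyer.Rank1Residual.X11b.BDPRouteOpenInputDescent
import HarnessLib

/-! # Line `bdpline`, stub S1 `stub_bdpLowerHalfRatSS` ON THE ALL-ADDITIVE CELL at `p ∤ h_K`: PRINT modulo
# ONE named fact (Bertolini–Longo–Venerucci 2026 Thm. A read through Castella–Wan 2024 Thm. 6.8)

Crux `AnticyclotomicEisensteinDivisibility` (stmt-BirchSwinnertonDyer-20727, route `SignedBaseChange`), line
`bdpline` (skeleton v23 b8ef25c3, lead bsd-line-sbc-p1 gen 4). The registered research stub S1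
`stub_bdpLowerHalfRatSS` = the RATIONAL Eisenstein half of the BDP anticyclotomic main conjecture at a good
supersingular `p ≥ 5`, `ρ̄` surjective, classical Heegner `K`, ANY conductor, in EVERY BDP frame. This file
proves its text with TWO extra binders inserted after `κ₂.IsAnticyclotomic →` —
`¬ p ∣ NumberField.classNumber K` (Bertolini–Longo–Venerucci Hyp. 1.1 (1) / Castella–Wan `δ = 0`) and
Hyp. 1.1 bullet 5 VERBATIM, "`H⁰(I_{ℚ_q}, E[p]) = 0` for every prime `q ∣ N`" (for `p ≥ 5`: every bad prime
of `E` is ADDITIVE) — from the named fact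
`BertoliniLongoVenerucci2026.thmA_castellaWan_thm68_exists_isCWBDPLFunction_charIdeal_map_le_rat` (BLV
Math. Ann. 2026 Thm. A, indefinite supersingular non-exceptional, through Castella–Wan Thm. 6.8; typed in
the currency of `CastellaWan2024.charIdeal_map_le_rat_of_thm53`; reliability flag `BLV-step4-Wan` in its
docstring) and the tree THEOREM `SignedBaseChangeAcDivFrameConcordance.span_map_eq_of_isCWBDPLFunction_of_isBDPLFunction`
(width seat bsd-line-sbc-p1-w2 gen 5, p634869: Castella–Wan's Prop. 2.1 frame and Castella 2018 Thm. 3.1's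
frame generate the same ideal of `𝒪_{ℂ_p}⟦T⟧`). Composition: the fact's inclusion along `toUnr : ℤ_p → R₀`
is pushed to `𝒪_{ℂ_p}⟦T⟧` along `R1.unrToCpInt` (the structure maps `J`, `J₀` of S1 ARE `R1.toCpInt`,
`R1.unrToCpInt`: `𝒪_{ℂ_p} ↪ ℂ_p` is injective) and moved to the given BDP frame by the concordance.

So on the sub-cell {every bad prime additive} × {`p ∤ h_K`} of the crux's supersingular slice, S1 is
PRINT modulo one named fact (two refereed sources; flag `BLV-step4-Wan`). Off that cell S1 stays research.
No summit statement is proved here; BSD / the crux are NOT proved by this file.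
-/

-- D-0017: single-problem summit, the namespace repeats the problem name by design.
set_option linter.dupNamespace false
set_option autoImplicit false

noncomputable section

open scoped Classical NumberField

open NumberField IsDedekindDomain Field
  Literature.NumberTheory.EllipticCurves Literature.NumberTheory.EllipticCurves.ModularForms
  Literature.NumberTheory.EllipticCurves.Rank1Residual Literature.NumberTheory.EllipticCurves.Castella2018
  Literature.NumberTheory.EllipticCurves.CastellaWan2024 Literature.NumberTheory.GaloisRepresentations
  Literature.NumberTheory.EllipticCurves.YanZhu2026
  Summit.BirchSwinnertonDyer.Rank1Residual.X11b Summit.BirchSwinnertonDyer.Rank1Residual.X11b.Halves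
  Summit.BirchSwinnertonDyer.BirchSwinnertonDyer.Theorems

namespace Summit.BirchSwinnertonDyer.BirchSwinnertonDyer.Theorems.SignedBaseChangeAcDivBdpLowerHalfAdditive

open Summit.BirchSwinnertonDyer.BirchSwinnertonDyer.Theses.SignedBaseChange


/-- **S1 on the all-additive cell at `p ∤ h_K` (PRINT modulo ONE named fact).** The registered text of
`stub_bdpLowerHalfRatSS` (line `bdpline` v23) with the two binders `¬ p ∣ NumberField.classNumber K` and
Hyp. 1.1 bullet 5 of Bertolini–Longo–Venerucci ("`H⁰(I_{ℚ_q}, E[p]) = 0` for every prime `q ∣ N`",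
verbatim in the currency of `BertoliniLongoVenerucci2026.DefiniteGrossPeriodSelmer`) inserted after
`κ₂.IsAnticyclotomic →`, from the named fact
`BertoliniLongoVenerucci2026.thmA_castellaWan_thm68_exists_isCWBDPLFunction_charIdeal_map_le_rat`
(flag `BLV-step4-Wan`) and the frame concordance THEOREM of p634869. The `Λ`-torsion hypothesis of the
registered text is not used (the fact's rational inclusion does not need it).
[cite: BertoliniLongoVenerucci2026, Thm. A with Hyp. 1.1 and Def. 8.3–8.4 (arXiv:2306.17784 p0003, p0037)]
[cite: CastellaWan2023, Thm. 6.8 (MS pp. 29–31), Prop. 2.1 (MS pp. 5–6)] [cite: Castella2018, Thm. 3.1 and Def. 2.2] -/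
theorem bdpLowerHalfRatSS_additive_of_BLV
    (hBLV : BertoliniLongoVenerucci2026.thmA_castellaWan_thm68_exists_isCWBDPLFunction_charIdeal_map_le_rat) :
    SignedTwoVariableInputs → Literature.NumberTheory.EllipticCurves.ModularForms.nonempty_modularParametrizationData → ∀ (W : WeierstrassCurve ℚ) [W.IsElliptic] [W.IsGloballyMinimal] (p : ℕ) [Fact p.Prime], 5 ≤ p → W.HasGoodReductionAtPrime p → W.frobeniusTrace p = 0 → Literature.NumberTheory.EllipticCurves.Rank1Residual.Surj W p → ∀ (K : Type) [Field K] [NumberField K] (ι : PadicAlgCl p ≃+* ℂ) (v vbar : IsDedekindDomain.HeightOneSpectrum (NumberField.RingOfIntegers K)) (κ₁ κ₂ : Literature.NumberTheory.EllipticCurves.ZpExtension K p) (γ₁ γ₂ : Field.absoluteGaloisGroup K) [Fact (Literature.NumberTheory.EllipticCurves.ZpExtension.IsTopGeneratorPair κ₁ κ₂ γ₁ γ₂)] [NeZero (NumberField.discr K).natAbs] (N : ℕ) [NeZero N] (f : CuspForm (CongruenceSubgroup.Gamma0 N) 2), Literature.NumberTheory.EllipticCurves.ModularForms.IsNewformOf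 W f → (N : ℤ) = W.conductorNorm ℤ → Literature.NumberTheory.EllipticCurves.IsImaginaryQuadratic K → ((Ideal.span {(p : ℤ)}).primesOver (NumberField.RingOfIntegers K)).ncard = 2 → ((p : ℕ) : NumberField.RingOfIntegers K) ∈ v.asIdeal → ((p : ℕ) : NumberField.RingOfIntegers K) ∈ vbar.asIdeal → vbar ≠ v → (∀ (w : NumberField.InfinitePlace K) (k : NumberField.RingOfIntegers K), k ∈ v.asIdeal ↔ ‖ι.symm (w.embedding (k : K))‖ < 1) → IsCoprime (N : ℤ) (NumberField.discr K) → (∀ ℓ : ℕ, ℓ.Prime → ℓ ∣ N → ((Ideal.span {(ℓ : ℤ)}).primesOver (NumberField.RingOfIntegers K)).ncard = 2) → Odd (NumberField.discr K) → NumberField.discr K ≠ -3 → κ₁.IsCyclotomic → κ₂.IsAnticyclotomic → ¬ p ∣ NumberField.classNumber K → (∀ q : ℕ, q.Prime → q ∣ N → ∀ v' : IsDedekindDomain.HeightOneSpectrum (NumberField.RingOfIntegers ℚ), ((q : ℕ) : NumberField.RingOfIntegers ℚ) ∈ v'.asIdeal → ∀ 𝔓 ∈ v'.primesAbove, ∀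 P : W.geomTorsion (p : ℤ), (∀ σ ∈ 𝔓.inertia (Field.absoluteGaloisGroup ℚ), σ • P = P) → P = 0) → (haveI : Fact (κ₂.IsTopGenerator γ₂) := ⟨Literature.NumberTheory.EllipticCurves.YanZhu2026.isTopGenerator_of_pair (κ₁ := κ₁) (γ₁ := γ₁)⟩; Module.IsTorsion (Literature.NumberTheory.EllipticCurves.IwasawaAlgebra p) (Literature.NumberTheory.EllipticCurves.Castella2018.AcSelmer.XAc (W.baseChange K) p κ₂ vbar ∅ γ₂)) → ∀ (ΩK : ℂ) (Ωp' : (Literature.NumberTheory.EllipticCurves.unrIntegers p)ˣ) (L : Literature.NumberTheory.EllipticCurves.UnrSeries p), ΩK ≠ 0 → Literature.NumberTheory.EllipticCurves.IsBDPLFunction ι v κ₂ γ₂ f ΩK ((Ωp' : Literature.NumberTheory.EllipticCurves.unrIntegers p) : PadicComplex p) L → ∀ J : ℤ_[p] →+* PadicComplexInt p, (∀ x : ℤ_[p], ((J x : PadicComplexInt p) : PadicComplex p) = ((x : ℚ_[p]) : PadicComplex p)) → ∀ (J₀ : Literature.NumberTheory.EllipticCurves.unrIntegers p →+* PadicComplexInt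 p), (∀ x : Literature.NumberTheory.EllipticCurves.unrIntegers p, ((J₀ x : PadicComplexInt p) : PadicComplex p) = (x : PadicComplex p)) → ∃ k : ℕ, ∀ y ∈ (haveI : Fact (κ₂.IsTopGenerator γ₂) := ⟨Literature.NumberTheory.EllipticCurves.YanZhu2026.isTopGenerator_of_pair (κ₁ := κ₁) (γ₁ := γ₁)⟩; Literature.NumberTheory.EllipticCurves.Castella2018.AcSelmer.XAc.charIdeal (W.baseChange K) p κ₂ vbar ∅ γ₂).map (PowerSeries.map J), PowerSeries.C (((p : ℕ) : PadicComplexInt p) ^ k) * y ∈ Ideal.span {PowerSeries.map J₀ L} := by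
  intro hIn hmodP W _ _ p _ hp hgood ha0 hs K _ _ ι v vbar κ₁ κ₂ γ₁ γ₂ _ _ N _ f hf hN hK hsplit hv hvbar hvv hι hcop hHeeg hodd
    hne3 hκ₁ hκ₂ hh h5 htors ΩK Ωp' L hΩK hL J hJ J₀ hJ₀
  haveI hγF : Fact (κ₂.IsTopGenerator γ₂) := ⟨isTopGenerator_of_pair (κ₁ := κ₁) (γ₁ := γ₁)⟩
  have hprime : p.Prime := Fact.out
  have hp2 : p ≠ 2 := by omega
  -- the named fact at `(ι, W, K, v, v̄, κ₂, γ₂, f)`: a Castella–Wan frame and the rational inclusion along `toUnr`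
  obtain ⟨ΩKw, Ωpw, LW, hΩKw, hLW, hk⟩ :=
    hBLV ι W K v vbar κ₂ γ₂ hf hN hp hgood ha0 hs hK hsplit hv hι hvbar hvv hHeeg hcop hh h5 hκ₂
  obtain ⟨k, hkle⟩ := hk (toUnr p) (coe_toUnr p)
  -- the structure maps of S1 are the canonical ones (`𝒪_{ℂ_p} ↪ ℂ_p` is injective)
  have hJ₀eq : J₀ = R1.unrToCpInt p :=
    RingHom.ext fun x ↦ Subtype.ext ((hJ₀ x).trans (R1.coe_unrToCpInt p x).symm)
  subst hJ₀eq
  have hJeq : J = R1.toCpInt p :=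
    RingHom.ext fun x ↦ Subtype.ext ((hJ x).trans (R1.coe_toCpInt p x).symm)
  subst hJeq
  -- the two frames generate the same ideal of `𝒪_{ℂ_p}⟦T⟧` (width seat's concordance theorem)
  have hN' : (W.conductorNorm ℤ : ℕ) = N := by exact_mod_cast hN.symm
  have hpN : ¬ p ∣ N := by
    rw [← hN']
    exact not_dvd_conductorNorm_of_hasGoodReductionAtPrime W hgood
  have hpD : ¬ (p : ℤ) ∣ NumberField.discr K :=
    not_dvd_discr_of_ncard_primesOver hprime (by rw [hK.1]; exact hsplit)
  have hconc : Ideal.span {PowerSeries.map (R1.unrToCpInt p) LW} =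
      Ideal.span {PowerSeries.map (R1.unrToCpInt p) L} :=
    SignedBaseChangeAcDivFrameConcordance.span_map_eq_of_isCWBDPLFunction_of_isBDPLFunction hp2 hK hκ₂
      hγF.out hpN hpD hΩKw hΩK (coe_units_unrIntegers_ne_zero Ωpw) (coe_units_unrIntegers_ne_zero Ωp') hLW hL
  -- push the inclusion along `R₀ → 𝒪_{ℂ_p}`
  refine ⟨k, fun y hy ↦ ?_⟩
  have hmap := Ideal.map_mono (f := PowerSeries.map (R1.unrToCpInt p)) hkle
  rw [Ideal.map_mul, Ideal.map_span, Set.image_singleton, Ideal.map_span, Set.image_singleton, Ideal.map_map,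
    ← R1.map_toCpInt_eq_comp, PowerSeries.map_C, map_pow, map_natCast, hconc] at hmap
  exact hmap (Ideal.mul_mem_mul (Ideal.mem_span_singleton_self _) hy)

end Summit.BirchSwinnertonDyer.BirchSwinnertonDyer.Theorems.SignedBaseChangeAcDivBdpLowerHalfAdditive

end
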